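import Mathlib
import HarnessLib
import Literature.Analysis.PDE.LoewnerNirenbergKelvin
import Summits.NavierStokesRegularity.NavierStokesRegularity.Theorems.PoloidalWindowDoorLrcModEntireWeightSourceTranslate

/-!
# Route `PoloidalWindowDoor`, item `LrcModEntire` (stmt-NavierStokesRegularity-20428), cell (Q4-sonic, straight branch), case I, PERIODIC branch —
# THE DIFFERENCE ROW (E3_D): the vertical equations of `v` and of its horizontal translate have the same source

Cell ns-regularity-ideate, LEAD-lineage seat ns-poloidal-K2-p3 g17 (`--supports stmt-NavierStokesRegularity-20428`).  T2B-g17 v9 §8(8b)/§9.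

Write `f := ∂ₜv + (v·∇)v − Δv` for the intrinsic residual, `θ := v₂`, `v^a := v(·, · + a)` for a HORIZONTAL vector `a`.  On the (TH) slab
(`∂₂v_b = μ(t,x₂)∂_bv₂`):
* `residual_translate` — the residual of the translate is the translate of the residual: `f^{(a)}(t,x) = f(t, x + a)` (pure calculus: `∂ₜ`, `(·∇)·`, `Δ`
  commute with translations);
* ★ `verticalResidual_difference` — **`(1−μ)·(f₂(t,x+a) − f₂(t,x)) = (μ_t − μ_zz)·ϑ + (μ_z/2)(θ(x+a) + θ(x))·ϑ − 2μ_z·(∂₂θ(x+a) − ∂₂θ(x))`**, `ϑ := θ(x+a) − θ(x)`,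
  at every `x` of the slab — the two weight sources agree (`…WeightSourceTranslate.weightSource_translate_eq`), and the source DEFINES `(1−μ)f₂` up to the displayed
  terms.  This is the row (E3_D) of the memo in invariant form: LINEAR in the differences `(v^a − v)`, NO source term; with `f₂ = θ_t + v·∇θ − Δθ` and
  `Δθ = (1−μ)Δₕθ` on the slab (`…TwistingTHFlatRidgeQuarticLawTools.laplacian_two_eq_rho_mul_horiz_of_plane`) it is the second-order row of the mixed system for
  `(ϑ, ⟪v^a_h − v_h, e⟫, ⟪v^a_h − v_h, Je⟫)` to which `…SheetSystemMixed.eq_zero_of_mixedSystem_template` is applied in sheared coordinates.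

WHAT THIS IS NOT: not a claim about Navier–Stokes regularity and not a stub of the registry; class-level bookkeeping for the residual research cell
`stub_Q4sonicLineNeg` of `Cruxes/LrcModEntire/Lines/twist_split.lean` v13 (bears_on LADDER-NS N0 via item 20428).
-/

noncomputable section

set_option linter.dupNamespace false

namespace Summit.NavierStokesRegularity.NavierStokesRegularity.Theorems.PoloidalWindowDoorLrcModEntireVerticalDifferenceRow

open Set Function Filter Topology Metric InnerProductSpace
open scoped RealInnerProductSpace InnerProductSpace Laplacian ContDiff
open Literature.Analysis Literature.Analysis.FluidPDE
open Summit.NavierStokesRegularity.NavierStokesRegularity.Theorems.PoloidalWindowDoorLrcModEntireWeightSourceTranslate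

variable {C : ℝ} {v : ℝ → EuclideanSpace ℝ (Fin 3) → EuclideanSpace ℝ (Fin 3)}

/-- **The residual of the translate is the translate of the residual** (pure calculus). -/
theorem residual_translate (v : ℝ → EuclideanSpace ℝ (Fin 3) → EuclideanSpace ℝ (Fin 3)) (a : EuclideanSpace ℝ (Fin 3)) (t : ℝ)
    (x : EuclideanSpace ℝ (Fin 3)) :
    timeDerivWithin (Iio 0) (fun s y => v s (y + a)) t x + convect ((fun s y => v s (y + a)) t) ((fun s y => v s (y + a)) t) x
        - Δ ((fun s y => v s (y + a)) t) x =
      timeDerivWithin (Iio 0) v t (x + a) + convect (v t) (v t) (x + a) - Δ (v t) (x + a) := by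
  have h1 : timeDerivWithin (Iio 0) (fun s y => v s (y + a)) t x = timeDerivWithin (Iio 0) v t (x + a) := rfl
  have h2 : convect ((fun s y => v s (y + a)) t) ((fun s y => v s (y + a)) t) x = convect (v t) (v t) (x + a) := by
    show fderiv ℝ (fun y => v t (y + a)) x (v t (x + a)) = fderiv ℝ (v t) (x + a) (v t (x + a))
    rw [fderiv_comp_add_right]
  have h3 : Δ ((fun s y => v s (y + a)) t) x = Δ (v t) (x + a) := by
    show Δ (fun y => v t (y + a)) x = Δ (v t) (x + a)
    exact Literature.Analysis.PDE.LoewnerNirenberg.laplacian_translate_add (v t) a x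
  rw [h1, h2, h3]

section Class

variable (hrate : HasTypeITimeDecay C v) (hcont : ContinuousOn (uncurry v) (Iio (0 : ℝ) ×ˢ univ))
  (hmild : ∀ s t : ℝ, s < t → t < 0 → ∀ x,
    v t x = UnboundedOperators.heatExtension (v s) (t - s) x - oseenDuhamel 1 s v v t x)
  (hdiv : ∀ t < 0, VectorCalculus.IsDivFree (v t))
include hrate hcont hmild hdiv

/-- ★ **THE DIFFERENCE ROW (E3_D), invariant form.**  On the (TH) slab, for a horizontal translation `a`:
`(1−μ)·(f₂(t,x+a) − f₂(t,x)) = (μ_t − μ_zz)(θ(x+a) − θ(x)) + (μ_z/2)(θ(x+a) + θ(x))(θ(x+a) − θ(x)) − 2μ_z(∂₂θ(x+a) − ∂₂θ(x))` (`θ = v₂(t,·)`,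
`μ_t, μ_z, μ_zz` at `(t, x₂)`). -/
theorem verticalResidual_difference
    (hpol : ∀ s < 0, ∀ y, ⟪curl (v s) y, EuclideanSpace.single 2 1⟫_ℝ = 0) {μ : ℝ → ℝ → ℝ}
    (hμ : ContDiff ℝ 3 (uncurry μ)) {t ρ : ℝ} (ht : t < 0)
    (hslab : ∀ y : EuclideanSpace ℝ (Fin 3), |y 2| < ρ → ∀ᶠ z in 𝓝 ((t, y) : ℝ × EuclideanSpace ℝ (Fin 3)), ∀ b : Fin 3, b ≠ 2 →
      fderiv ℝ (v z.1) z.2 (EuclideanSpace.single 2 1) b = μ z.1 (z.2 2) * fderiv ℝ (v z.1) z.2 (EuclideanSpace.single b 1) 2)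
    {x : EuclideanSpace ℝ (Fin 3)} (hx : |x 2| < ρ) {a : EuclideanSpace ℝ (Fin 3)} (ha : a 2 = 0) :
    (1 - μ t (x 2)) *
        ((timeDerivWithin (Iio 0) v t (x + a) + convect (v t) (v t) (x + a) - Δ (v t) (x + a)) 2
          - (timeDerivWithin (Iio 0) v t x + convect (v t) (v t) x - Δ (v t) x) 2) =
      (deriv (fun s => μ s (x 2)) t - deriv (deriv (μ t)) (x 2)) * (v t (x + a) 2 - v t x 2)
        + deriv (μ t) (x 2) / 2 * (v t (x + a) 2 + v t x 2) * (v t (x + a) 2 - v t x 2)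
        - 2 * deriv (μ t) (x 2) * (fderiv ℝ (v t) (x + a) (EuclideanSpace.single 2 1) 2 - fderiv ℝ (v t) x (EuclideanSpace.single 2 1) 2) := by
  have h := weightSource_translate_eq hrate hcont hmild hdiv hpol hμ ht hslab hx ha
  have hxa : (x + a) 2 = x 2 := by simp [ha]
  simp only [hxa] at h
  linear_combination (1 / 2 : ℝ) * h

end Class

end Summit.NavierStokesRegularity.NavierStokesRegularity.Theorems.PoloidalWindowDoorLrcModEntireVerticalDifferenceRow

end
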